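import Literature.Analysis.FunctionSpaces.WeakLp
import Mathlib.MeasureTheory.Function.ConvergenceInMeasure
import HarnessLib

/-!
# Fatou's lemma for the weak-`Lᵖ` quasinorm

Analysis/FunctionSpaces support file (theorems only; no definitions, no named facts). For a sequence
`fₙ → f` pointwise a.e., the distribution function and the weak-`Lᵖ` quasinorm of the tree's
`WeakLp.lean` (`eWeakLpPow f p μ = sup_{t} tᵖ μ{t < ‖f‖}`, `MemWeakLp`) are lower semicontinuous:

* `measure_lt_enorm_le_liminf_of_ae_tendsto` — `μ{t < ‖f‖} ≤ liminfₙ μ{t < ‖fₙ‖}` (Grafakos,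
  Prop. 1.1.3: if `|f| ≤ liminf |fₙ|` a.e. then `d_f ≤ liminf d_{fₙ}`; here from Fatou's lemma for the
  indicators of the super-level sets);
* `eWeakLpPow_le_liminf_of_ae_tendsto` — `‖f‖^p_{L^{p,∞}} ≤ liminfₙ ‖fₙ‖^p_{L^{p,∞}}`;
* `eWeakLpPow_le_of_ae_tendsto`, `memWeakLp_of_ae_tendsto` — a uniform bound `‖fₙ‖^p_{L^{p,∞}} ≤ C`
  passes to the a.e. limit, which is then in weak `Lᵖ` when `C < ∞`;
* `eWeakLpPow_le_of_tendsto_eLpNorm`, `memWeakLp_of_tendsto_eLpNorm` — the same for `L^q`-limits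
  (convergence in measure ⇒ a.e. subsequence), e.g. `L¹(G)`-limits on a bounded set.

This is the stability of weak-Lorentz bounds under a.e. (hence, along a subsequence, under `L¹_loc`)
convergence used in compactness arguments at critical regularity (e.g. Wu 2026, Lemma 3.2, cell
`ns-claims` C177 `Step_construct`; Type-I / `L^{3,∞}` blow-up profiles).

## Mathlib / tree search

Tree: `eWeakLpPow`, `MemWeakLp`, `eWeakLpPow_le_iff`, `rpow_mul_meas_lt_le_eWeakLpPow` (`WeakLp.lean`);
`eWeakLpPow_congr_ae` (`WeakLpSplit.lean`); no `liminf` lemma for `eWeakLpPow`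
(`lean search 'eWeakLpPow.*liminf|MemWeakLp.*of_tendsto'`: none). Mathlib: `lintegral_liminf_le'`,
`lintegral_indicator_one₀`, `ENNReal.liminf_const_mul`-type algebra via `le_liminf_of_le`.

## References

* L. Grafakos, *Classical Fourier Analysis*, 3rd ed., GTM 249 (2014), §1.1.1, Prop. 1.1.3
  (properties of the distribution function, incl. the Fatou property). [Grafakos2014]
-/

noncomputable section

open MeasureTheory Filter Set Topology
open scoped ENNReal NNReal

namespace Literature.Analysis.FunctionSpaces

variable {α : Type*} [MeasurableSpace α] {E : Type*} [NormedAddCommGroup E]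
variable {μ : Measure α} {f : ℕ → α → E} {g : α → E} {p : ℝ≥0∞}

/-- In `ℝ≥0∞`, multiplication by a constant is monotone, hence `c · liminf uₙ ≤ liminf (c · uₙ)`
(no continuity needed). [folklore] -/
private theorem _root_.ENNReal.const_mul_liminf_le (c : ℝ≥0∞) (u : ℕ → ℝ≥0∞) :
    c * liminf u atTop ≤ liminf (fun n => c * u n) atTop := by
  rw [Filter.liminf_eq_iSup_iInf_of_nat, Filter.liminf_eq_iSup_iInf_of_nat, ENNReal.mul_iSup]
  refine iSup_mono fun N => le_iInf fun n => le_iInf fun hn => ?_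
  exact mul_le_mul_right (iInf₂_le n hn) c

/-- **Fatou for the distribution function** (Grafakos, Prop. 1.1.3): if `fₙ → g` a.e. and the `fₙ`,
`g` are a.e.-strongly measurable, then for every level `t`,
`μ{t < ‖g‖} ≤ liminfₙ μ{t < ‖fₙ‖}`. (At a point of convergence with `t < ‖g x‖`, eventually
`t < ‖fₙ x‖`, so the indicator of the limit's super-level set is below the liminf of the indicators;
then Fatou's lemma.) [cite: Grafakos2014, Prop. 1.1.3] -/
theorem measure_lt_enorm_le_liminf_of_ae_tendsto (hf : ∀ n, AEStronglyMeasurable (f n) μ)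
    (hg : AEStronglyMeasurable g μ)
    (hlim : ∀ᵐ x ∂μ, Tendsto (fun n => f n x) atTop (𝓝 (g x))) (t : ℝ≥0∞) :
    μ {x | t < ‖g x‖ₑ} ≤ liminf (fun n => μ {x | t < ‖f n x‖ₑ}) atTop := by
  -- the super-level sets are null-measurable
  have hA : NullMeasurableSet {x | t < ‖g x‖ₑ} μ :=
    hg.enorm.nullMeasurableSet_preimage measurableSet_Ioi
  have hAn : ∀ n, NullMeasurableSet {x | t < ‖f n x‖ₑ} μ := fun n =>
    (hf n).enorm.nullMeasurableSet_preimage measurableSet_Ioi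
  -- indicator of the limit set ≤ liminf of the indicators, a.e.
  have hind : ∀ᵐ x ∂μ, ({x | t < ‖g x‖ₑ}.indicator (1 : α → ℝ≥0∞)) x ≤
      liminf (fun n => ({x | t < ‖f n x‖ₑ}.indicator (1 : α → ℝ≥0∞)) x) atTop := by
    filter_upwards [hlim] with x hx
    by_cases hxA : t < ‖g x‖ₑ
    · -- eventually `t < ‖f n x‖`, so the indicators are eventually `1`
      have hev : ∀ᶠ n in atTop, t < ‖f n x‖ₑ :=
        (hx.enorm.eventually (isOpen_Ioi.mem_nhds hxA))
      have h1 : liminf (fun n => ({x | t < ‖f n x‖ₑ}.indicator (1 : α → ℝ≥0∞)) x) atTop = 1 := by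
        refine Tendsto.liminf_eq ?_
        refine (tendsto_congr' ?_).2 tendsto_const_nhds
        filter_upwards [hev] with n hn
        rw [Set.indicator_of_mem (by exact hn), Pi.one_apply]
      rw [h1, Set.indicator_of_mem (by exact hxA), Pi.one_apply]
    · rw [Set.indicator_of_notMem (by exact hxA)]
      exact bot_le
  calc μ {x | t < ‖g x‖ₑ}
      = ∫⁻ x, ({x | t < ‖g x‖ₑ}.indicator (1 : α → ℝ≥0∞)) x ∂μ := (lintegral_indicator_one₀ hA).symm
    _ ≤ ∫⁻ x, liminf (fun n => ({x | t < ‖f n x‖ₑ}.indicator (1 : α → ℝ≥0∞)) x) atTop ∂μ :=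
        lintegral_mono_ae hind
    _ ≤ liminf (fun n => ∫⁻ x, ({x | t < ‖f n x‖ₑ}.indicator (1 : α → ℝ≥0∞)) x ∂μ) atTop :=
        lintegral_liminf_le' fun n => (aemeasurable_indicator_iff₀ (hAn n)).2 aemeasurable_const
    _ = liminf (fun n => μ {x | t < ‖f n x‖ₑ}) atTop := by
        refine liminf_congr (Eventually.of_forall fun n => ?_)
        exact lintegral_indicator_one₀ (hAn n)

/-- **Fatou for the weak-`Lᵖ` quasinorm**: if `fₙ → g` a.e. (all a.e.-strongly measurable) then
`‖g‖^p_{L^{p,∞}} ≤ liminfₙ ‖fₙ‖^p_{L^{p,∞}}`, i.e. `eWeakLpPow g p μ ≤ liminfₙ eWeakLpPow (fₙ) p μ`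
(levelwise Fatou, then `tᵖ ·` and the supremum over levels). [cite: Grafakos2014, Prop. 1.1.3] -/
theorem eWeakLpPow_le_liminf_of_ae_tendsto (hf : ∀ n, AEStronglyMeasurable (f n) μ)
    (hg : AEStronglyMeasurable g μ)
    (hlim : ∀ᵐ x ∂μ, Tendsto (fun n => f n x) atTop (𝓝 (g x))) :
    eWeakLpPow g p μ ≤ liminf (fun n => eWeakLpPow (f n) p μ) atTop := by
  rw [eWeakLpPow_le_iff]
  intro t
  have hlev := measure_lt_enorm_le_liminf_of_ae_tendsto hf hg hlim (t : ℝ≥0∞)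
  -- `tᵖ μ{t < ‖g‖} ≤ tᵖ liminf μ{t < ‖fₙ‖} ≤ liminf (tᵖ μ{t < ‖fₙ‖}) ≤ liminf ‖fₙ‖^p`
  calc ((t : ℝ≥0∞) ^ p.toReal) * μ {x | (t : ℝ≥0∞) < ‖g x‖ₑ}
      ≤ ((t : ℝ≥0∞) ^ p.toReal) * liminf (fun n => μ {x | (t : ℝ≥0∞) < ‖f n x‖ₑ}) atTop := by
        gcongr
    _ ≤ liminf (fun n => ((t : ℝ≥0∞) ^ p.toReal) * μ {x | (t : ℝ≥0∞) < ‖f n x‖ₑ}) atTop :=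
        ENNReal.const_mul_liminf_le _ _
    _ ≤ liminf (fun n => eWeakLpPow (f n) p μ) atTop :=
        liminf_le_liminf (Eventually.of_forall fun n => rpow_mul_meas_lt_le_eWeakLpPow (f n) p μ t)

/-- **Uniform weak-`Lᵖ` bounds pass to a.e. limits**: if `‖fₙ‖^p_{L^{p,∞}} ≤ C` for all `n` and
`fₙ → g` a.e., then `‖g‖^p_{L^{p,∞}} ≤ C`. [cite: Grafakos2014, Prop. 1.1.3] -/
theorem eWeakLpPow_le_of_ae_tendsto (hf : ∀ n, AEStronglyMeasurable (f n) μ)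
    (hg : AEStronglyMeasurable g μ)
    (hlim : ∀ᵐ x ∂μ, Tendsto (fun n => f n x) atTop (𝓝 (g x))) {C : ℝ≥0∞}
    (hC : ∀ n, eWeakLpPow (f n) p μ ≤ C) : eWeakLpPow g p μ ≤ C := by
  refine (eWeakLpPow_le_liminf_of_ae_tendsto hf hg hlim).trans ?_
  refine liminf_le_of_frequently_le (Frequently.of_forall hC) ?_
  isBoundedDefault

/-- **A.e. limits of uniformly weak-`Lᵖ`-bounded sequences are in weak `Lᵖ`** (finite uniform bound).
[cite: Grafakos2014, Prop. 1.1.3] -/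
theorem memWeakLp_of_ae_tendsto (hf : ∀ n, AEStronglyMeasurable (f n) μ)
    (hg : AEStronglyMeasurable g μ)
    (hlim : ∀ᵐ x ∂μ, Tendsto (fun n => f n x) atTop (𝓝 (g x))) {C : ℝ≥0∞} (hCtop : C < ∞)
    (hC : ∀ n, eWeakLpPow (f n) p μ ≤ C) : MemWeakLp g p μ :=
  ⟨hg, (eWeakLpPow_le_of_ae_tendsto hf hg hlim hC).trans_lt hCtop⟩

/-- **Uniform weak-`Lᵖ` bounds pass to `L^q` limits** (any `q ≠ 0`): if `‖fₙ‖^p_{L^{p,∞}} ≤ C` and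
`fₙ → g` in `L^q(μ)` (`eLpNorm (fₙ - g) q μ → 0`), then `‖g‖^p_{L^{p,∞}} ≤ C` — convergence in `L^q`
gives convergence in measure, hence an a.e.-convergent subsequence, to which the Fatou property applies.
(The `L¹_loc` form of Wu 2026, Lemma 3.2, on a fixed bounded set `G` is the case `μ = volume|_G`,
`q = 1`.) [cite: Grafakos2014, Prop. 1.1.3] -/
theorem eWeakLpPow_le_of_tendsto_eLpNorm (hf : ∀ n, AEStronglyMeasurable (f n) μ)
    (hg : AEStronglyMeasurable g μ) {q : ℝ≥0∞} (hq : q ≠ 0)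
    (hlim : Tendsto (fun n => eLpNorm (f n - g) q μ) atTop (𝓝 0)) {C : ℝ≥0∞}
    (hC : ∀ n, eWeakLpPow (f n) p μ ≤ C) : eWeakLpPow g p μ ≤ C := by
  obtain ⟨ns, -, hae⟩ := (tendstoInMeasure_of_tendsto_eLpNorm hq hf hg hlim).exists_seq_tendsto_ae
  exact eWeakLpPow_le_of_ae_tendsto (fun k => hf (ns k)) hg hae fun k => hC (ns k)

/-- **`L^q` limits of uniformly weak-`Lᵖ`-bounded sequences are in weak `Lᵖ`** (finite uniform bound).
[cite: Grafakos2014, Prop. 1.1.3] -/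
theorem memWeakLp_of_tendsto_eLpNorm (hf : ∀ n, AEStronglyMeasurable (f n) μ)
    (hg : AEStronglyMeasurable g μ) {q : ℝ≥0∞} (hq : q ≠ 0)
    (hlim : Tendsto (fun n => eLpNorm (f n - g) q μ) atTop (𝓝 0)) {C : ℝ≥0∞} (hCtop : C < ∞)
    (hC : ∀ n, eWeakLpPow (f n) p μ ≤ C) : MemWeakLp g p μ :=
  ⟨hg, (eWeakLpPow_le_of_tendsto_eLpNorm hf hg hq hlim hC).trans_lt hCtop⟩

end Literature.Analysis.FunctionSpaces

end
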